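import Mathlib
import Literature.Analysis.FluidPDE.Tao2016AveragedNS.ShiftSetCascadeFlux
import Summits.NavierStokesRegularity.NavierStokesRegularity.Theorems.TaoLadderRungThreeGappedFrontRobustLipschitz
import HarnessLib

/-!
# Shift-set pseudo-flows `PseudoFlowOnShift 𝕊`: the bond flux from two slot bounds and the qualitative
  Lipschitz inputs of the block bootstrap (helper for item stmt-NavierStokesRegularity-22988
  `GappedFrontRobustV2Flat`, crux K_B♭ of route TaoLadderRungTwoFlat)

Small `𝕊`-parametrised tools split off `…BlockBehindOn` (400-line limit): on a nearest-neighbour shift set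
without the class `(1,1,1)`, `|X_n| ≤ P`, `|X_{n+1}| ≤ Q` give
`|B_𝕊(n)| ≤ (1+ε₀)^{5n/2} (∑_{botShifts 𝕊}|α|) (P² Q + P Q²)` (`abs_botSumOn_le_two_slot`: the one-way
class contributes `P²Q`, each backscatter class `PQ²`); and the block energy / each amplitude of a
pseudo-flow on `𝕊` is Lipschitz in time (`pseudoFlowOnShift_block_energy_lipschitz`,
`pseudoFlowOnShift_amplitude_lipschitz`, from `GappedFrontRobust.exists_lipschitz_of_contDiffOn_Icc`).

HONEST FRAMING: elementary bookkeeping about Tao-type MODEL lattice pseudo-flows (Tao 2016 §4 Lemma 4.1)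
on a general nearest-neighbour shift set; nothing here concerns the Navier–Stokes equations; nothing is
asserted about any table (p1 g12).
-/

noncomputable section

-- the sub-problem namespace `Summit.NavierStokesRegularity.NavierStokesRegularity` repeats the summit name by design (D-0017)
set_option linter.dupNamespace false

namespace Summit.NavierStokesRegularity.NavierStokesRegularity.Theorems

open Set MeasureTheory intervalIntegral Literature.Analysis.FluidPDE Literature.Analysis.FluidPDE.TaoCascade

namespace GappedFrontRobustOn

variable {m : ℕ} {𝕊 : Finset (ℤ × ℤ × ℤ)}

/-! ### The bond flux from two slot bounds -/

/-- **Bond flux from two slot bounds** (nearest-neighbour `𝕊` without `(1,1,1)`, `1+ε₀ > 0`): if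
`|X_{i,n}(t)| ≤ P` and `|X_{i,n+1}(t)| ≤ Q` (`P, Q ≥ 0`), then
`|B_𝕊(n)(t)| ≤ (1+ε₀)^{5n/2} (∑_{botShifts 𝕊}|α|) (P² Q + P Q²)` (the one-way class contributes `P²Q`,
each backscatter class `PQ²`). [cite: Tao2016AveragedNS, §4 proof of Lemma 4.1 (v) (the boundary terms) and p. 9 footnote 7] -/
theorem abs_botSumOn_le_two_slot (h𝕊 : IsNearestNeighbourSet 𝕊)
    (h111 : ((1 : ℤ), (1 : ℤ), (1 : ℤ)) ∉ 𝕊) (ε₀ : ℝ) (hε : 0 < 1 + ε₀)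
    (α : Fin m → Fin m → Fin m → ℤ × ℤ × ℤ → ℝ) (X : Fin m → ℤ → ℝ → ℝ) (n : ℤ) (t : ℝ)
    {P Q : ℝ} (hP0 : 0 ≤ P) (hQ0 : 0 ≤ Q) (hP : ∀ i, |X i n t| ≤ P) (hQ : ∀ i, |X i (n + 1) t| ≤ Q) :
    |botSumOn 𝕊 ε₀ α X n t| ≤ (1 + ε₀) ^ ((5 : ℝ) * n / 2) * coeffAbsOn (botShifts 𝕊) α *
      (P ^ 2 * Q + P * Q ^ 2) := by
  set B : ℤ → ℝ := fun k => if k = n then P else Q with hB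
  have hB0 : ∀ k, 0 ≤ B k := fun k => by
    simp only [hB]; split_ifs <;> assumption
  have hBn : B n = P := by simp [hB]
  have hBn1 : B (n + 1) = Q := by simp [hB]
  have hslot : ∀ j : ℤ, (j = 0 ∨ j = 1) → ∀ i, |X i (n + j) t| ≤ B (n + j) := by
    rintro j (rfl | rfl) i
    · simpa [hBn] using hP i
    · rw [hBn1]; exact hQ i
  have h := abs_fullSumOn_le_of_slot_bounds (𝕋 := botShifts 𝕊) ε₀ hε α X n t hB0
    (fun μ hμ i => by
      have hμ𝕊 : μ ∈ 𝕊 := (Finset.mem_filter.mp hμ).1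
      exact ⟨hslot _ (h𝕊 μ hμ𝕊).1 i, hslot _ (h𝕊 μ hμ𝕊).2.1 i, hslot _ (h𝕊 μ hμ𝕊).2.2 i⟩)
  set G : ℝ := P ^ 2 * Q + P * Q ^ 2 with hG
  have hprod : ∀ μ ∈ botShifts 𝕊, B (n + μ.1) * B (n + μ.2.1) * B (n + μ.2.2) ≤ G := by
    intro μ hμ
    obtain ⟨hμ𝕊, hμ3⟩ := Finset.mem_filter.mp hμ
    obtain ⟨h1, h2, -⟩ := h𝕊 μ hμ𝕊
    have hne : ¬ (μ.1 = 1 ∧ μ.2.1 = 1) := by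
      rintro ⟨ha, hb⟩
      apply h111
      have : μ = ((1 : ℤ), (1 : ℤ), (1 : ℤ)) := Prod.ext ha (Prod.ext hb hμ3)
      rwa [this] at hμ𝕊
    rw [hμ3, hBn1]
    rcases h1 with ha | ha <;> rcases h2 with hb | hb
    · rw [ha, hb, add_zero, hBn]
      nlinarith [mul_nonneg hP0 (sq_nonneg Q)]
    · rw [ha, hb, add_zero, hBn, hBn1]
      nlinarith [mul_nonneg (sq_nonneg P) hQ0]
    · rw [ha, hb, add_zero, hBn, hBn1]
      nlinarith [mul_nonneg (sq_nonneg P) hQ0]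
    · exact absurd ⟨ha, hb⟩ hne
  have hsum : ∑ i₁, ∑ i₂, ∑ i₃, ∑ μ ∈ botShifts 𝕊,
      |α i₁ i₂ i₃ μ| * (B (n + μ.1) * B (n + μ.2.1) * B (n + μ.2.2)) ≤
      coeffAbsOn (botShifts 𝕊) α * G := by
    simp only [coeffAbsOn, Finset.sum_mul]
    refine Finset.sum_le_sum fun i₁ _ => Finset.sum_le_sum fun i₂ _ =>
      Finset.sum_le_sum fun i₃ _ => Finset.sum_le_sum fun μ hμ => ?_
    exact mul_le_mul_of_nonneg_left (hprod μ hμ) (abs_nonneg _)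
  have hΛ : 0 ≤ (1 + ε₀) ^ ((5 : ℝ) * n / 2) := (Real.rpow_pos_of_pos hε _).le
  calc |botSumOn 𝕊 ε₀ α X n t|
      ≤ (1 + ε₀) ^ ((5 : ℝ) * n / 2) * ∑ i₁, ∑ i₂, ∑ i₃, ∑ μ ∈ botShifts 𝕊,
          |α i₁ i₂ i₃ μ| * (B (n + μ.1) * B (n + μ.2.1) * B (n + μ.2.2)) := h
    _ ≤ (1 + ε₀) ^ ((5 : ℝ) * n / 2) * (coeffAbsOn (botShifts 𝕊) α * G) :=
        mul_le_mul_of_nonneg_left hsum hΛ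
    _ = (1 + ε₀) ^ ((5 : ℝ) * n / 2) * coeffAbsOn (botShifts 𝕊) α * (P ^ 2 * Q + P * Q ^ 2) := by
        simp only [hG]; ring

variable {τ ε₀ : ℝ} {α : Fin m → Fin m → Fin m → ℤ × ℤ × ℤ → ℝ} {κ₁ κ₂ : ℝ}
  {S₀ F₀ B₀ : Fin m → ℤ → ℝ} {S F : Fin m → ℤ → ℝ → ℝ}

/-! ### Qualitative Lipschitz inputs -/

/-- **The block energy of a pseudo-flow on `𝕊` is Lipschitz in time** (finite sums of `C¹` energies).
[cite: Tao2016AveragedNS, §4 Lemma 4.1 (i) (continuously differentiable energies)] -/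
theorem pseudoFlowOnShift_block_energy_lipschitz (h : PseudoFlowOnShift 𝕊 τ ε₀ α κ₁ κ₂ S₀ F₀ B₀ S F)
    (hτ : 0 < τ) (K : ℤ) (Lb : ℕ) :
    ∃ L : ℝ, 0 ≤ L ∧ ∀ s ∈ Icc 0 τ, ∀ t ∈ Icc 0 τ,
      |∑ k ∈ Finset.range Lb, ∑ i, F i (K + k) t - ∑ k ∈ Finset.range Lb, ∑ i, F i (K + k) s| ≤
        L * |t - s| := by
  have hcd : ContDiffOn ℝ 1 (fun t => ∑ k ∈ Finset.range Lb, ∑ i, F i (K + k) t) (Icc 0 τ) :=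
    ContDiffOn.sum fun k _ => ContDiffOn.sum fun i _ => h.contDiffOn_F i (K + k)
  exact GappedFrontRobust.exists_lipschitz_of_contDiffOn_Icc hτ hcd

/-- **Each amplitude of a pseudo-flow on `𝕊` is Lipschitz in time** (one shell at a time).
[cite: Tao2016AveragedNS, §4 Lemma 4.1 (i) (continuously differentiable amplitudes)] -/
theorem pseudoFlowOnShift_amplitude_lipschitz (h : PseudoFlowOnShift 𝕊 τ ε₀ α κ₁ κ₂ S₀ F₀ B₀ S F)
    (hτ : 0 < τ) (i : Fin m) (k : ℤ) :
    ∃ L : ℝ, 0 ≤ L ∧ ∀ s ∈ Icc 0 τ, ∀ t ∈ Icc 0 τ, |S i k t - S i k s| ≤ L * |t - s| :=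
  GappedFrontRobust.exists_lipschitz_of_contDiffOn_Icc hτ (h.contDiffOn_S i k)

end GappedFrontRobustOn

end Summit.NavierStokesRegularity.NavierStokesRegularity.Theorems

end
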